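import Mathlib
import HarnessLib
import Literature.MathematicalPhysics.QuantumFieldTheory.Balaban1983to89.B10

/-!
# `Balaban1983to89.B10SectCExpansion` — the expansion (53)–(57) of Sect. C of T. Bałaban, *Ultraviolet stability of
three-dimensional lattice pure gauge field theories*, Commun. Math. Phys. **102**, 255–275 (1985) [Balaban1985UV3]

(Cell numbering B10; journal page = PDF page + 254; read from the page renders
`run/shared/lean/pub/pub-balaban/b2b-balaban-ref1/pages/1985-cmp102-uv-stability-3d/1985-cmp102-uv-stability-3d-p015-x2.png`
(p. 269) and `…-p016-x2.png` (p. 270), and the OCR text `paper:balaban1985-cmp102-uv-stability-3d` pp. 15–16.)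

HONEST FRAMING (mega-formalization `lit-balaban`, verbatim): statement-level skeleton of published theorems with
citation tags; proofs where landed; nothing here is a claim about the Yang–Mills mass gap.

WHY THIS FILE EXISTS.  Unit `lit-balaban-r07` (reader/typer of B10, Phase 1: one SKELETON row + one typed statement per
printed item).  The B10 cluster of the audit cell `pub-balaban` (`…Balaban1983to89.B10`, `…B10SectAGathering`,
`…B10Eq24Cumulant`, `…B10NestedMinimizer`, … — 30 modules, all untouched here) types Theorems 1–2 and the displays
(1)–(8), (11), (20)–(52), (55), (58)–(71); its leaf `B10SectAGathering.Bound55` records (48)–(54), (56)–(57) only as *the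
printed proof* of (55)/(58).  Four displays of that stretch carry mathematical content of their own and had no
declaration anywhere in the tree (checked 2026-08-20: no `[cite: Balaban1985UV3, …]` tag in `lean/Literature/` or
`lean/Summits/` names (53), (54), (56) or (57)):

* **(53)** p. 269 — the expansion of the action `A^η(U_k(exp i(A − D̃(A))V_k^{(k)}))` around `U_{k+1}` in the fluctuation
  variable `A`, regrouped *"using also orthogonality relations following from the definitions of operations and
  configurations used above"* into `A^η(U_{k+1}) + ½⟨H₁A, Δ₁H₁A⟩ − ⟨H₁D̃⁽²⁾(A), J⟩ + {Ṽ(A)}`;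
* **(54)** p. 269 — *"For the quadratic form above we have ½⟨H₁A, Δ₁H₁A⟩ − ⟨H₁D̃⁽²⁾(A), J⟩ = ½⟨A, Δ_kA⟩, where Δ_k was
  defined by (3.156) in [5], and investigated in Sect. E of that paper"* ([5] = [Balaban1985BackgroundPropagators],
  cell modules `…B9SectECov` ((3.155)–(3.157)), `…B9Eq3112` ((3.156)));
* **(56)** pp. 269–270 — the form of the low-order terms: non-local polynomials
  `Σ_{b₁,…,b_m ⊂ B(Λ_{k+1})} ⟨v(g_k, b₁, …, b_m), A(b₁), …, A(b_m)⟩, m ≥ 3`, with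
  `|v(g_k, b₁, …, b_m)| ≤ O(g_k^{m−2}) exp(−½δ₀𝓛({b_i}))`;
* **(57)** p. 270 — the same for the coefficients coming from the expansion of a previous-scale term `𝒫_j(Y_j, U_k)`,
  `Y_j = (y, c₁, …, c_n)`: `|v(g_k, b₁, …, b_m)| ≤ O(g_k^m){Π_{i=1}^n O(1) exp(−½κ₁(M₁L^jη)^{−1}|c_{i,−} − y|)
  (L^jη)^{−1}|c_{i,−} − y|(L^jη)²} exp(−½δ₀𝓛({b_i} ∪ {y}))`.

WHAT IS TYPED, AND HOW.  Over abstract carriers that only NAME the printed objects (the series defines `H₁`, `Δ₁`,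
`𝓗₁`, `J`, `V` in [7] = [Balaban1985Variational] (74), (78)–(81), (174)–(175), `D̃` in B10 (17), `Δ_k` in [5] (3.156);
none of them is constructed here): `Expansion53` (the last member of (53)), `Line2_53` (its second member),
`Orthogonality53` (the located reading of the *"orthogonality relations"*: exactly the three inner products that the
passage from the second to the third member of (53) drops, plus the symmetry of `Δ₁` and `D̃ = D̃⁽²⁾ + D̃₃`),
`QuadForm54`, `Bound56`, `Bound57`.  Every such `def … : Prop` is a HYPOTHESIS downstream, never asserted.

WHAT IS KERNEL-CERTIFIED ([folklore] inner-product algebra, no content of the series): `expansion53_of_line2` — the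
second member of (53) and the relations `Orthogonality53` give the third member VERBATIM (so the typed reading of the
unprinted "orthogonality relations" is at least sufficient); `quadForm54_unique` — (54) determines `Δ_k` among
symmetric operators (polarization), i.e. (54) can serve as the definition of the quadratic form of `Δ_k` on the
fluctuation space, which is how p. 269 uses it (*"using the definition (3.155) [5] … we obtain (55)"*);
`expansion53_54` — (53) ∧ (54) give the exponent `A^η(U_{k+1}) + ½⟨A, Δ_kA⟩ + Ṽ(A)` that enters (55);
`bound56_irrelevant` — under (56) with `g_k ≤ 1` every coefficient is `≤ O(1)·g_k·exp(−½δ₀𝓛)` (the degree floor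
`m ≥ 3` is what makes the vertices small; cell census G-adv9-30 located this floor).

NOT HERE (deliberately): the first member of (53) (`A^η(U_{k+1}) + ⟨𝓗, J⟩ + ½⟨𝓗, Δ(U_{k+1})𝓗⟩ + V₀(𝓗)`, which is the
expansion (26)/(174) of [7] — an edge to `…B11`, not a B10 statement); the objects themselves; (55) and (58) (typed as
`B10SectAGathering.Bound55` / `.Cumulant58`); any claim that `Orthogonality53` holds for the series' operators (that is
[7]'s business: J ⟂ H₁(ker Q) by criticality of `U_{k+1}` under the block-average constraint, and the construction of
`𝓗₁` in Sect. G of [7]).  Value = typed skeleton rows E53, E54, E56, E57 of `HOME/SKELETON.md` §B10 + three pieces of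
certified bookkeeping; NOT summit progress.  v1.1 (append-only, section `Terms43`): the per-term shape (43)–(45) of the
interaction terms 𝒫_j(Y_j, U_k) and its first-step case (34) — `Shape43` (degree floor n ≥ 2 + decay), `Bound44`,
`Bound45`, with `bound44_of_shape43`, `bound44_two_powers` proved (rows E34, E43, E44, E45).  v1.2 (append-only,
section `Resummation45`, unit `lit-balaban-r07` gen 2): the two printed summations of p. 267 kernel-checked —
(44) ⇒ (45) (`blockSum45_le_two_mul_sq`, `bound45_of_bound44`: distributivity + degree floor + geometric tail) and
(45) ⇒ (46) (`bound46_of_bound45`: block count `(M₁L^jη)^{−3}|Λ_k|` per scale + the d = 3 power counting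
`B10.powerCounting_d3`, whence the import of `…B10`).
-/

namespace Literature.MathematicalPhysics.QuantumFieldTheory.Balaban1983to89.B10SectCExpansion

open scoped RealInnerProductSpace

section Expansion53

variable {F F' : Type*} [NormedAddCommGroup F] [InnerProductSpace ℝ F]
  [NormedAddCommGroup F'] [InnerProductSpace ℝ F']

/-- The objects named in **(53)** p. 269 [15], over two real inner-product spaces: `F` = the fluctuation fields `A` on
the bonds of `B(Λ_{k+1})` (unit lattice `T₁^{(k)}`), `F'` = 𝔤-valued fields on the `η`-lattice (where `U_{k+1}`, `J`,
`𝓗` live).  `H₁ : F → F'` the linearized-minimizer operator and `ℋ₁ A` the non-linear part of the representative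
`𝓗 = H₁(A − D̃(A)) + 𝓗₁` ([7] Sect. G, (174)–(175)); `Δ₁` the Hessian-type operator and `J` the first-variation vector
of [7] (74), (78)–(81); `V` the higher-order functional; `D = D̃` the solution of B10 (17) with `D₂ = D̃⁽²⁾` its
second-order part and `D₃ = D̃₃` the rest; `actFl A = A^η(U_k(exp i(A − D̃(A))V_k^{(k)}))` and `actK1 = A^η(U_{k+1})`.
Only NAMES; nothing is constructed. [cite: Balaban1985UV3, (53) p.269] -/
structure ExpansionData (F F' : Type*) [NormedAddCommGroup F] [InnerProductSpace ℝ F]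
    [NormedAddCommGroup F'] [InnerProductSpace ℝ F'] where
  H₁ : F →ₗ[ℝ] F'
  Δ₁ : F' →ₗ[ℝ] F'
  J : F'
  D : F → F
  D₂ : F → F
  D₃ : F → F
  ℋ₁ : F → F'
  V : F' → ℝ
  actFl : F → ℝ
  actK1 : ℝ

/-- `Ṽ(A)` := *"the expression in curly brackets {⋯} in (53)"* (p. 269 [15]), verbatim:
`{ −⟨H₁D̃₃(A), J⟩ − ⟨H₁A, Δ₁H₁D̃(A)⟩ + ½⟨H₁D̃(A), Δ₁H₁D̃(A)⟩ + ½⟨𝓗₁, Δ₁𝓗₁⟩ + V(H₁A − H₁D̃(A) + 𝓗₁) }`.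
A definition with body over the named objects. [cite: Balaban1985UV3, (53) p.269] -/
noncomputable def Vtilde53 (d : ExpansionData F F') (A : F) : ℝ :=
  -⟪d.H₁ (d.D₃ A), d.J⟫ - ⟪d.H₁ A, d.Δ₁ (d.H₁ (d.D A))⟫
    + (1 / 2 : ℝ) * ⟪d.H₁ (d.D A), d.Δ₁ (d.H₁ (d.D A))⟫ + (1 / 2 : ℝ) * ⟪d.ℋ₁ A, d.Δ₁ (d.ℋ₁ A)⟫
    + d.V (d.H₁ A - d.H₁ (d.D A) + d.ℋ₁ A)

/-- The SECOND member of **(53)** p. 269 [15], verbatim: *"= A^η(U_{k+1}) + ⟨H₁(A − D̃(A)) + 𝓗₁, J⟩ +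
½⟨H₁(A − D̃(A)) + 𝓗₁, Δ₁(H₁(A − D̃(A)) + 𝓗₁)⟩ + V(H₁(A − D̃(A)) + 𝓗₁)"*, asserted for the fields `A` of a set `S`
(print: the support of `χ δ(QA) δ_{Ax}(A)` in (51)).  Reached in print from the first member *"A^η(U_k(exp i(A −
D̃(A))V_k^{(k)})) = A^η(U_{k+1}) + ⟨𝓗, J⟩ + ½⟨𝓗, Δ(U_{k+1})𝓗⟩ + V₀(𝓗)"* by *"the expansion (26), Eq. (174), and the
formulas (74), (78)–(81) of [7]"* — an edge to [Balaban1985Variational], not typed here.  Hypothesis-shaped leaf.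
[cite: Balaban1985UV3, (53) p.269] -/
def Line2_53 (d : ExpansionData F F') (S : Set F) : Prop :=
  ∀ A ∈ S, d.actFl A = d.actK1 + ⟪d.H₁ (A - d.D A) + d.ℋ₁ A, d.J⟫
    + (1 / 2 : ℝ) * ⟪d.H₁ (A - d.D A) + d.ℋ₁ A, d.Δ₁ (d.H₁ (A - d.D A) + d.ℋ₁ A)⟫
    + d.V (d.H₁ (A - d.D A) + d.ℋ₁ A)

/-- LOCATED READING of p. 269 [15] *"We have used also orthogonality relations following from the definitions of
operations and configurations used above."* — print does not list them.  Comparing the second and third members of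
(53) term by term, exactly three inner products are dropped: `⟨H₁A, J⟩`, `⟨𝓗₁, J⟩` and the cross term
`⟨H₁(A − D̃(A)), Δ₁𝓗₁⟩`; the regrouping also uses the symmetry of `Δ₁` and the splitting `D̃ = D̃⁽²⁾ + D̃₃`.  This
`Prop` records precisely that (on the set `S` of admissible `A`); it is a HYPOTHESIS (in the series: `J ⟂ H₁A` for
`QA = 0` by the criticality of `U_{k+1}` under the block-average constraints, and the construction of `𝓗₁` in Sect. G
of [7]) — `expansion53_of_line2` certifies that it suffices. [cite: Balaban1985UV3, (53) p.269] -/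
def Orthogonality53 (d : ExpansionData F F') (S : Set F) : Prop :=
  d.Δ₁.IsSymmetric ∧ ∀ A ∈ S, d.D A = d.D₂ A + d.D₃ A ∧ ⟪d.H₁ A, d.J⟫ = 0 ∧ ⟪d.ℋ₁ A, d.J⟫ = 0 ∧
    ⟪d.H₁ (A - d.D A), d.Δ₁ (d.ℋ₁ A)⟫ = 0

/-- **(53)** p. 269 [15], its LAST member, verbatim: *"A^η(U_k(exp i(A − D̃(A))V_k^{(k)})) = … = A^η(U_{k+1}) +
½⟨H₁A, Δ₁H₁A⟩ − ⟨H₁D̃⁽²⁾(A), J⟩ + { −⟨H₁D̃₃(A), J⟩ − ⟨H₁A, Δ₁H₁D̃(A)⟩ + ½⟨H₁D̃(A), Δ₁H₁D̃(A)⟩ + ½⟨𝓗₁, Δ₁𝓗₁⟩ +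
V(H₁A − H₁D̃(A) + 𝓗₁)}. (53)"*, for the admissible fields `A ∈ S`.  Printed proof: the expansion of [7] ((26), (174),
(74), (78)–(81)) and the orthogonality relations (`Orthogonality53`).  Hypothesis-shaped leaf.
[cite: Balaban1985UV3, (53) p.269] -/
def Expansion53 (d : ExpansionData F F') (S : Set F) : Prop :=
  ∀ A ∈ S, d.actFl A = d.actK1 + (1 / 2 : ℝ) * ⟪d.H₁ A, d.Δ₁ (d.H₁ A)⟫ - ⟪d.H₁ (d.D₂ A), d.J⟫ + Vtilde53 d A

/-- CERTIFIED BOOKKEEPING: the second member of (53) together with the located orthogonality relations gives the third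
member of (53) exactly as printed (real inner-product algebra; no content of the series).
[cite: Balaban1985UV3, (53) p.269] -/
theorem expansion53_of_line2 (d : ExpansionData F F') (S : Set F) (hL : Line2_53 d S)
    (hO : Orthogonality53 d S) : Expansion53 d S := by
  intro A hA
  obtain ⟨hsym, hO'⟩ := hO
  obtain ⟨hD, h1, h2, h3⟩ := hO' A hA
  have e1 : ⟪d.H₁ (d.D A), d.J⟫ = ⟪d.H₁ (d.D₂ A), d.J⟫ + ⟪d.H₁ (d.D₃ A), d.J⟫ := by
    rw [hD, map_add, inner_add_left]
  have e2 : ⟪d.H₁ (d.D A), d.Δ₁ (d.H₁ A)⟫ = ⟪d.H₁ A, d.Δ₁ (d.H₁ (d.D A))⟫ := by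
    rw [← hsym, real_inner_comm]
  have e3 : ⟪d.ℋ₁ A, d.Δ₁ (d.H₁ A)⟫ = ⟪d.H₁ A, d.Δ₁ (d.ℋ₁ A)⟫ := by
    rw [← hsym, real_inner_comm]
  have e4 : ⟪d.ℋ₁ A, d.Δ₁ (d.H₁ (d.D A))⟫ = ⟪d.H₁ (d.D A), d.Δ₁ (d.ℋ₁ A)⟫ := by
    rw [← hsym, real_inner_comm]
  have h3' : ⟪d.H₁ A, d.Δ₁ (d.ℋ₁ A)⟫ - ⟪d.H₁ (d.D A), d.Δ₁ (d.ℋ₁ A)⟫ = 0 := by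
    rw [← inner_sub_left, ← map_sub]; exact h3
  rw [hL A hA, Vtilde53]
  simp only [map_sub, map_add, inner_add_left, inner_add_right, inner_sub_left, inner_sub_right]
  linarith [e1, e2, e3, e4, h3', h1, h2]

end Expansion53

section QuadForm54

variable {F F' : Type*} [NormedAddCommGroup F] [InnerProductSpace ℝ F]
  [NormedAddCommGroup F'] [InnerProductSpace ℝ F']

/-- **(54)** p. 269 [15], verbatim: *"For the quadratic form above we have ½⟨H₁A, Δ₁H₁A⟩ − ⟨H₁D̃⁽²⁾(A), J⟩ =
½⟨A, Δ_kA⟩, (54) where Δ_k was defined by (3.156) in [5], and investigated in Sect. E of that paper."*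
([5] = [Balaban1985BackgroundPropagators]; cell records `…B9SectECov` (3.155)–(3.157), `…B9Eq3112` (3.156).)
`Δk : F → F` is the operator `Δ_k` on the fluctuation space; the identity is typed for all `A` (both sides are
quadratic forms).  Hypothesis-shaped leaf (in print it is the definition (3.155)–(3.156) of [5] read on B10's objects).
[cite: Balaban1985UV3, (54) p.269] -/
def QuadForm54 (d : ExpansionData F F') (Δk : F →ₗ[ℝ] F) : Prop :=
  ∀ A : F, (1 / 2 : ℝ) * ⟪d.H₁ A, d.Δ₁ (d.H₁ A)⟫ - ⟪d.H₁ (d.D₂ A), d.J⟫ = (1 / 2 : ℝ) * ⟪A, Δk A⟫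

/-- CERTIFIED BOOKKEEPING: (54) DETERMINES `Δ_k` among symmetric operators — two symmetric operators with the same
quadratic form coincide (polarization, Mathlib `LinearMap.IsSymmetric.inner_map_self_eq_zero`).  So (54) can be read
as the definition of the quadratic form of `Δ_k`, which is how p. 269 uses it (*"where Δ_k was defined by (3.156) in
[5]"*).  Re-derived bookkeeping about the printed identity; no content of the series. [cite: Balaban1985UV3, (54) p.269] -/
theorem quadForm54_unique (d : ExpansionData F F') {Δk Δk' : F →ₗ[ℝ] F} (h : QuadForm54 d Δk)
    (h' : QuadForm54 d Δk') (hs : Δk.IsSymmetric) (hs' : Δk'.IsSymmetric) : Δk = Δk' := by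
  have hT : (Δk - Δk').IsSymmetric := hs.sub hs'
  have hzero : ∀ x, ⟪(Δk - Δk') x, x⟫ = 0 := by
    intro x
    have e := h x
    have e' := h' x
    have c1 := real_inner_comm (Δk x) x
    have c2 := real_inner_comm (Δk' x) x
    rw [LinearMap.sub_apply, inner_sub_left]
    linarith
  exact sub_eq_zero.mp (hT.inner_map_self_eq_zero.mp hzero)

/-- CERTIFIED BOOKKEEPING: (53) and (54) together give the exponent that p. 269 feeds into (55): *"Denoting the
expression in curly brackets {⋯} in (53) by Ṽ(A), using the definition (3.155) [5], … we obtain (55)"*, i.e.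
`A^η(U_k(exp i(A − D̃(A))V_k^{(k)})) = A^η(U_{k+1}) + ½⟨A, Δ_kA⟩ + Ṽ(A)` on the admissible fields.
[cite: Balaban1985UV3, (53)–(55) p.269] -/
theorem expansion53_54 (d : ExpansionData F F') (S : Set F) (Δk : F →ₗ[ℝ] F) (h53 : Expansion53 d S)
    (h54 : QuadForm54 d Δk) :
    ∀ A ∈ S, d.actFl A = d.actK1 + (1 / 2 : ℝ) * ⟪A, Δk A⟫ + Vtilde53 d A := by
  intro A hA
  rw [h53 A hA]
  linarith [h54 A]

end QuadForm54

section Vertices56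

/-- The geometry named in **(56)–(57)** pp. 269–270 [15–16]: `Bond` = bonds of `B(Λ_{k+1}) ⊂ T₁^{(k)}`, `Site` = points
of the unit lattice; `treeLen bs ys = 𝓛(bs ∪ ys)` — *"(let us recall that 𝓛({b_i}) denotes the length of a shortest graph
on the unit lattice, connecting points of b_i and possibly other points)"* (p. 270), here with an explicit set `ys` of
additional points (`{y}` in (57)); `cminus c = c₋`; `dist x y = |x − y|`.  Only NAMES. [cite: Balaban1985UV3, (56)–(57) pp.269–270] -/
structure VertexGeometry where
  Bond : Type
  Site : Type
  treeLen : Set Bond → Set Site → ℝ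
  cminus : Bond → Site
  dist : Site → Site → ℝ

/-- A family of coefficient sizes `|v(g_k, b₁, …, b_m)|`, `m ∈ ℕ`, `bᵢ ∈ Bond` — the norms of the multilinear
coefficients of a non-local polynomial `Σ_m Σ_{b₁,…,b_m} ⟨v(g_k, b₁, …, b_m), A(b₁), …, A(b_m)⟩` of (56). [cite: Balaban1985UV3, (56) p.269] -/
abbrev CoeffSizes (X : VertexGeometry) : Type := (m : ℕ) → (Fin m → X.Bond) → ℝ

/-- **(56)** pp. 269–270 [15–16], verbatim: *"Lower order terms are given by local polynomials for v(g_kA), and by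
non-local polynomials for 1/g_k²Ṽ(g_kA) ⟦print: «1/g2ᵏṼ(g_kA)», sic⟧. They correspond to tree graphs with vertices defined by terms in the
expansions of local functions V₀(A′), C(A′) (A′ is a gauge field configuration on the η-lattice), and lines defined by
propagators H, H₁, 𝔊. External legs correspond to H₁A. An expression corresponding to such a graph has the form
Σ_{b₁,…,b_m ⊂ B(Λ_{k+1})} ⟨v(g_k, b₁, …, b_m), A(b₁), …, A(b_m)⟩, m ≥ 3, (56) and |v(g_k, b₁, …, b_m)| ≤ O(g_k^{m−2})
exp(−½δ₀𝓛({b_i}))"*.  Typed for a family of coefficient sizes `v` with the `O(·)` constant `C` explicit: the DEGREE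
FLOOR (only `m ≥ 3` occurs; cell census G-adv9-30) and the bound.  (`m − 2` is natural-number subtraction; harmless since
`v m · = 0` for `m < 3`.)  Hypothesis-shaped leaf. [cite: Balaban1985UV3, (56) pp.269–270] -/
def Bound56 (X : VertexGeometry) (v : CoeffSizes X) (gk δ₀ C : ℝ) : Prop :=
  (∀ (m : ℕ) (b : Fin m → X.Bond), v m b ≠ 0 → 3 ≤ m) ∧
    ∀ (m : ℕ) (b : Fin m → X.Bond), |v m b| ≤ C * gk ^ (m - 2) * Real.exp (-(δ₀ / 2) * X.treeLen (Set.range b) ∅)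

/-- **(57)** p. 270 [16], verbatim: *"Let us consider now expansions of the terms 𝒫_j. We use the bounds (44) which hold
not only for U_k, but for an arbitrary configuration having the same properties and bounds as U_k. We expand a term of
this type in (55) with respect to 𝓗 up to the sixth order; the remainder can be estimated by the right-hand side of
(44), with an additional power of g_kp(g_k) missing, so that the overall factor is (g_kp(g_k))⁷. Estimating next in a
similar way as in (45), (46) we get O((L^kε)^{3+κ₀})|B(Λ_{k+1})|. For lower order terms we expand the function into
powers of g_kA, and we estimate terms with an overall power greater than six as above. Lower order terms have again the
form of non-local polynomials (56), but now a coefficient v connected with the expansion of 𝒫_j(Y_j, U_k) has the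
estimate |v(g_k, b₁, …, b_m)| ≤ O(g_k^m){Π_{i=1}^n O(1) exp(−½κ₁(M₁L^jη)^{−1}|c_{i,−} − y|) × (L^jη)^{−1}|c_{i,−} −
y|(L^jη)²} exp(−½δ₀𝓛({b_i} ∪ {y})). (57) We sum up all the coefficients at the same monomial in A. We get a coefficient
which, by bound similar to (45), (46), can be estimated as in (56) (with O(g_k^m))."*  Typed for the coefficient sizes
`w` attached to ONE previous-scale term `Y_j = (y, c₁, …, c_n)` ((43) p. 266), with `ℓ = L^jη` and the two `O(·)`
constants `C`, `C'` explicit.  Hypothesis-shaped leaf. [cite: Balaban1985UV3, (57) p.270] -/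
def Bound57 (X : VertexGeometry) (w : CoeffSizes X) (gk κ₁ δ₀ M₁ ℓ C C' : ℝ) (y : X.Site) {n : ℕ}
    (c : Fin n → X.Bond) : Prop :=
  ∀ (m : ℕ) (b : Fin m → X.Bond), |w m b| ≤ C * gk ^ m *
    (∏ i, C' * Real.exp (-(κ₁ / 2) * (M₁ * ℓ)⁻¹ * X.dist (X.cminus (c i)) y) *
      ((ℓ⁻¹ * X.dist (X.cminus (c i)) y) * ℓ ^ 2)) *
    Real.exp (-(δ₀ / 2) * X.treeLen (Set.range b) {y})

/-- The resummed coefficients of p. 270 [16] (*"We sum up all the coefficients at the same monomial in A. We get a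
coefficient which … can be estimated as in (56) (with O(g_k^m))"*): the bound of (56) with exponent `m` instead of
`m − 2`. Hypothesis-shaped leaf. [cite: Balaban1985UV3, p.270 (after (57))] -/
def Bound56Resummed (X : VertexGeometry) (w : CoeffSizes X) (gk δ₀ C : ℝ) : Prop :=
  ∀ (m : ℕ) (b : Fin m → X.Bond), |w m b| ≤ C * gk ^ m * Real.exp (-(δ₀ / 2) * X.treeLen (Set.range b) ∅)

/-- CERTIFIED BOOKKEEPING (why the degree floor matters): under (56) with `0 ≤ g_k ≤ 1` every coefficient satisfies
`|v(g_k, b₁, …, b_m)| ≤ C·g_k·exp(−½δ₀𝓛({b_i}))` — at least one power of the small coupling, uniformly in `m`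
(p. 267 [13]: the interaction terms *"behave like irrelevant variables"*; p. 269 [15]: *"Lower order terms"*).  Real
arithmetic on the printed bound (56); no content of the series. [cite: Balaban1985UV3, (56) pp.269–270] -/
theorem bound56_irrelevant (X : VertexGeometry) (v : CoeffSizes X) {gk δ₀ C : ℝ} (hC : 0 ≤ C)
    (hg0 : 0 ≤ gk) (hg1 : gk ≤ 1) (h : Bound56 X v gk δ₀ C) (m : ℕ) (b : Fin m → X.Bond) :
    |v m b| ≤ C * gk * Real.exp (-(δ₀ / 2) * X.treeLen (Set.range b) ∅) := by
  obtain ⟨hfloor, hbound⟩ := h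
  by_cases hv : v m b = 0
  · rw [hv, abs_zero]; positivity
  · have hm : 3 ≤ m := hfloor m b hv
    have hpow : gk ^ (m - 2) ≤ gk := by
      calc gk ^ (m - 2) ≤ gk ^ 1 := pow_le_pow_of_le_one hg0 hg1 (by omega)
        _ = gk := pow_one gk
    calc |v m b| ≤ C * gk ^ (m - 2) * Real.exp (-(δ₀ / 2) * X.treeLen (Set.range b) ∅) := hbound m b
      _ ≤ C * gk * Real.exp (-(δ₀ / 2) * X.treeLen (Set.range b) ∅) := by
        gcongr

end Vertices56

section Terms43

/-!
### v1.1 (append-only, same unit): the per-term shape (43)–(45) of the interaction terms (and (34) = its first-step case)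

The B10 cluster types the interaction terms only in aggregate (`B10.TowerRun.Pint` = Σ_jΣ_{Y_j}𝒫_j(Y_j, U_k), the summed
bound (46) = `B10.Bound46Printed`, whose docstring quotes (43)–(45)).  For the SKELETON rows E34, E43, E44, E45 the
per-term statements are typed here over the geometry carrier `VertexGeometry` of (56)–(57) (same bonds, sites, `c₋`,
distances), read from the renders `…-p010-x2.png` (p. 264), `…-p012-x2.png` (p. 266), `…-p013-x2.png` (p. 267).
-/

/-- Sizes of a family of terms indexed by `Y = (y, c₁, …, c_n)` ((34) p. 264, (43) p. 266): `P y n c` = `|𝒫_j(Y_j)|`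
(the norm of the multilinear coefficient) or `|𝒫_j(Y_j, U_k)|` (the evaluated term), `y` a big block (its
representative site), `c : Fin n → Bond` the bonds. [cite: Balaban1985UV3, (43) p.266] -/
abbrev TermSizes (X : VertexGeometry) : Type := X.Site → (n : ℕ) → (Fin n → X.Bond) → ℝ

/-- **(43)** p. 266 [12], verbatim: *"The expressions 𝒫_j(Y_j, U_k) are defined similarly to (35) ⟦sic: (34)⟧:
Y_j = (y, c₁, …, c_n), where y represents big blocks of L^jη-lattice, contained in Ω_k, i.e. y ∈ Ω_k^{(j)} ∩ M₁L^jηZ³,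
and c_i are bonds in Ω_k^{(j)}, |c_{i,−} − y| < R(g_j)M₁L^jη, 𝒫_j(Y_j, U_k) = ⟨𝒫_j(Y_j), B_k(c₁), …, B_k(c_n)⟩, n ≥ 2,
B_k(c) = (1/i) log Ū_k^j(Γ_{y,c₋} ∪ c ∪ Γ_{c₊,y}), c ∈ Ω_k^{(j)}, (43) |𝒫_j(Y_j)| ≤ O(1) Π_{i=1}^n exp(−κ₁(M₁L^jη)^{−1}
|c_{i,−} − y|)."*; its first-step case is **(34)** p. 264 [10]: *"𝒫₁(g₀, Y, U₁) = ⟨𝒫₁(g₀, Y), B₁(c₁), …, B₁(c_n)⟩,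
n ≥ 2, B₁(c) = (1/i) log Ū₁(Γ_{y,c₋} ∪ c ∪ Γ_{c₊,y}), |𝒫₁(g₀, Y)| ≤ O(g₀) Π_{i=1}^n exp(−κ₁M₁⁻¹|c_{i,−} − y|)"*
(`ℓ = L^jη = 1`, `C = O(g₀)`).  Typed for the coefficient sizes `P` with `ℓ = L^jη` and the `O(1)` constant `C`
explicit: the DEGREE FLOOR `n ≥ 2` (p. 267: *"Of course the condition n ≥ 2 plays a crucial role"*) and the decay
bound.  The loop variables `B_k(c)` are the axial-gauge data of (27) (cell module `…B10Eq27AxialLog`, `B27`).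
Hypothesis-shaped leaf. [cite: Balaban1985UV3, (43) p.266] -/
def Shape43 (X : VertexGeometry) (P : TermSizes X) (κ₁ M₁ ℓ C : ℝ) : Prop :=
  (∀ (y : X.Site) (n : ℕ) (c : Fin n → X.Bond), P y n c ≠ 0 → 2 ≤ n) ∧
    ∀ (y : X.Site) (n : ℕ) (c : Fin n → X.Bond),
      |P y n c| ≤ C * ∏ i, Real.exp (-(κ₁ * (M₁ * ℓ)⁻¹ * X.dist (X.cminus (c i)) y))

/-- **(44)** p. 267 [13], verbatim: *"The configuration U_k satisfies the following regularity condition on Ω_k: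
|U_k(∂p) − 1| < 2L²B₃g_{k−1}p(g_{k−1})η². This implies the condition |Ū_k^j(∂p′) − 1| < 4L²B₃g_{k−1}p(g_{k−1})(L^jη)²
for p′ ⊂ Ω_k^{(j)}, and from (43) we get |𝒫_j(Y_j, U_k)| ≤ O(1) Π_{i=1}^n exp(−κ₁(M₁L^jη)^{−1}|c_{i,−} − y|) ×
(L^jη)^{−1}|c_{i,−} − y| 8L²B₃g_{k−1}p(g_{k−1})(L^jη)². (44)"* — typed for the sizes `PU y n c = |𝒫_j(Y_j, U_k)|` with
the `i`-indexed factor read inside the product (one factor `(L^jη)^{−1}|c_{i,−} − y|·8L²B₃g_{k−1}p(g_{k−1})(L^jη)²` per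
loop variable `B_k(c_i)`, = the axial-gauge ladder bound of (28), cell `B10Eq27AxialLog.norm_B27_le`, times the
plaquette bound); `g = g_{k−1}`, `pg = p(g_{k−1})`, `ℓ = L^jη`.  Hypothesis-shaped leaf; `bound44_of_shape43`
certifies (43) + loop-variable bounds ⇒ (44).  (p. 270: used also *"for an arbitrary configuration having the same
properties and bounds as U_k"* — cell GAPS G-B10-05.) [cite: Balaban1985UV3, (44) p.267] -/
def Bound44 (X : VertexGeometry) (PU : TermSizes X) (κ₁ M₁ ℓ L B₃ g pg C : ℝ) : Prop :=
  ∀ (y : X.Site) (n : ℕ) (c : Fin n → X.Bond),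
    |PU y n c| ≤ C * ∏ i, (Real.exp (-(κ₁ * (M₁ * ℓ)⁻¹ * X.dist (X.cminus (c i)) y)) *
      ((ℓ⁻¹ * X.dist (X.cminus (c i)) y) * (8 * L ^ 2 * B₃ * g * pg * ℓ ^ 2)))

/-- **(45)** p. 267 [13], verbatim: *"By the assumption n ≥ 2, summation over all Y_j with y fixed yields for g_{k−1}
sufficiently small Σ_{Y_j: y = y₀} |𝒫_j(Y_j, U_k)| ≤ O(1)(O(M₁³)g_{k−1}p(g_{k−1}))²(L^jη)⁴. (45) Summation over y
gives the factor (M₁L^jη)^{−3}|Λ_k|, and finally summation over j = 1, …, k gives"* (46) (= `B10.Bound46Printed`;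
exponent arithmetic `B10.powerCounting_d3`).  Typed for the per-block sums `S y₀ = Σ_{Y_j: y = y₀}|𝒫_j(Y_j, U_k)|`
(only NAMED) with the two `O(·)` constants `C`, `CM = O(M₁³)` explicit (cell census C-B10-1: the M₁-power is not
load-bearing).  Hypothesis-shaped leaf. [cite: Balaban1985UV3, (45) p.267] -/
def Bound45 (X : VertexGeometry) (S : X.Site → ℝ) (CM g pg ℓ C : ℝ) : Prop :=
  ∀ y₀ : X.Site, S y₀ ≤ C * (CM * g * pg) ^ 2 * ℓ ^ 4

/-- CERTIFIED BOOKKEEPING ((43) ⇒ (44) as printed, "from (43) we get"): if the coefficient sizes satisfy the decay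
bound of (43), every loop variable obeys `|B_k(c_i)| ≤ (ℓ⁻¹|c_{i,−} − y|)·(8L²B₃ g p(g) ℓ²)` (the axial ladder (28)
with the plaquette bound 4L²B₃g_{k−1}p(g_{k−1})(L^jη)²), and the evaluated term is bounded multilinearly,
`|𝒫_j(Y_j, U_k)| ≤ |𝒫_j(Y_j)|·Π_i|B_k(c_i)|`, then (44) holds with the same constant.  Real arithmetic; no content of
the series. [cite: Balaban1985UV3, (43)–(44) pp.266–267] -/
theorem bound44_of_shape43 (X : VertexGeometry) (P PU : TermSizes X) (loop : X.Site → X.Bond → ℝ)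
    {κ₁ M₁ ℓ L B₃ g pg C : ℝ} (hC : 0 ≤ C) (h43 : Shape43 X P κ₁ M₁ ℓ C)
    (hloop_nonneg : ∀ y b, 0 ≤ loop y b)
    (hloop : ∀ y b, loop y b ≤ (ℓ⁻¹ * X.dist (X.cminus b) y) * (8 * L ^ 2 * B₃ * g * pg * ℓ ^ 2))
    (hmult : ∀ (y : X.Site) (n : ℕ) (c : Fin n → X.Bond), |PU y n c| ≤ |P y n c| * ∏ i, loop y (c i)) :
    Bound44 X PU κ₁ M₁ ℓ L B₃ g pg C := by
  intro y n c
  obtain ⟨-, hdec⟩ := h43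
  have hprod_nonneg : 0 ≤ ∏ i, loop y (c i) := Finset.prod_nonneg fun i _ => hloop_nonneg y (c i)
  calc |PU y n c| ≤ |P y n c| * ∏ i, loop y (c i) := hmult y n c
    _ ≤ (C * ∏ i, Real.exp (-(κ₁ * (M₁ * ℓ)⁻¹ * X.dist (X.cminus (c i)) y))) * ∏ i, loop y (c i) :=
        mul_le_mul_of_nonneg_right (hdec y n c) hprod_nonneg
    _ ≤ (C * ∏ i, Real.exp (-(κ₁ * (M₁ * ℓ)⁻¹ * X.dist (X.cminus (c i)) y))) *
          ∏ i, ((ℓ⁻¹ * X.dist (X.cminus (c i)) y) * (8 * L ^ 2 * B₃ * g * pg * ℓ ^ 2)) := by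
        apply mul_le_mul_of_nonneg_left
        · exact Finset.prod_le_prod (fun i _ => hloop_nonneg y (c i)) fun i _ => hloop y (c i)
        · exact mul_nonneg hC (Finset.prod_nonneg fun i _ => (Real.exp_pos _).le)
    _ = C * ∏ i, (Real.exp (-(κ₁ * (M₁ * ℓ)⁻¹ * X.dist (X.cminus (c i)) y)) *
          ((ℓ⁻¹ * X.dist (X.cminus (c i)) y) * (8 * L ^ 2 * B₃ * g * pg * ℓ ^ 2))) := by
        rw [mul_assoc, ← Finset.prod_mul_distrib]

/-- CERTIFIED BOOKKEEPING (why `n ≥ 2` is "crucial", p. 267): under (44), if each loop factor is at most `θ` with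
`0 ≤ θ ≤ 1` (print: `(L^jη)^{−1}|c_{i,−} − y| 8L²B₃g_{k−1}p(g_{k−1})(L^jη)² ≤ 8L²B₃R(g_j)M₁·g_{k−1}p(g_{k−1})(L^jη)²`,
small for g_{k−1} small) and the decay factors are `≤ 1` (`0 ≤ κ₁`, `0 < M₁ℓ`, distances `≥ 0`), then a nonzero term
has `|𝒫_j(Y_j, U_k)| ≤ C·θ²` — two powers of the small loop bound, the source of the `(…)²(L^jη)⁴` in (45).  Real
arithmetic; no content of the series. [cite: Balaban1985UV3, (44)–(45) p.267] -/
theorem bound44_two_powers (X : VertexGeometry) (P PU : TermSizes X) {κ₁ M₁ ℓ L B₃ g pg C θ : ℝ}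
    (hC : 0 ≤ C) (hκ : 0 ≤ κ₁) (hMℓ : 0 < M₁ * ℓ) (hdist : ∀ x y, 0 ≤ X.dist x y) (hθ0 : 0 ≤ θ) (hθ1 : θ ≤ 1)
    (hfloor : ∀ (y : X.Site) (n : ℕ) (c : Fin n → X.Bond), PU y n c ≠ 0 → P y n c ≠ 0)
    (h43 : Shape43 X P κ₁ M₁ ℓ C) (h44 : Bound44 X PU κ₁ M₁ ℓ L B₃ g pg C)
    (hsmall : ∀ (y : X.Site) (b : X.Bond),
      (ℓ⁻¹ * X.dist (X.cminus b) y) * (8 * L ^ 2 * B₃ * g * pg * ℓ ^ 2) ≤ θ)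
    (hfac_nonneg : ∀ (y : X.Site) (b : X.Bond),
      0 ≤ (ℓ⁻¹ * X.dist (X.cminus b) y) * (8 * L ^ 2 * B₃ * g * pg * ℓ ^ 2))
    (y : X.Site) (n : ℕ) (c : Fin n → X.Bond) (hne : PU y n c ≠ 0) : |PU y n c| ≤ C * θ ^ 2 := by
  have hn : 2 ≤ n := h43.1 y n c (hfloor y n c hne)
  have hfactor : ∀ i : Fin n, Real.exp (-(κ₁ * (M₁ * ℓ)⁻¹ * X.dist (X.cminus (c i)) y)) *
      ((ℓ⁻¹ * X.dist (X.cminus (c i)) y) * (8 * L ^ 2 * B₃ * g * pg * ℓ ^ 2)) ≤ θ := by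
    intro i
    have hexp : Real.exp (-(κ₁ * (M₁ * ℓ)⁻¹ * X.dist (X.cminus (c i)) y)) ≤ 1 := by
      rw [Real.exp_le_one_iff, neg_nonpos]
      exact mul_nonneg (mul_nonneg hκ (inv_nonneg.mpr hMℓ.le)) (hdist _ _)
    calc _ ≤ 1 * θ := mul_le_mul hexp (hsmall y (c i)) (hfac_nonneg y (c i)) zero_le_one
      _ = θ := one_mul θ
  have hfactor_nonneg : ∀ i : Fin n, 0 ≤ Real.exp (-(κ₁ * (M₁ * ℓ)⁻¹ * X.dist (X.cminus (c i)) y)) *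
      ((ℓ⁻¹ * X.dist (X.cminus (c i)) y) * (8 * L ^ 2 * B₃ * g * pg * ℓ ^ 2)) :=
    fun i => mul_nonneg (Real.exp_pos _).le (hfac_nonneg y (c i))
  have hprod : ∏ i : Fin n, Real.exp (-(κ₁ * (M₁ * ℓ)⁻¹ * X.dist (X.cminus (c i)) y)) *
      ((ℓ⁻¹ * X.dist (X.cminus (c i)) y) * (8 * L ^ 2 * B₃ * g * pg * ℓ ^ 2)) ≤ θ ^ n := by
    calc _ ≤ ∏ _i : Fin n, θ := Finset.prod_le_prod (fun i _ => hfactor_nonneg i) fun i _ => hfactor i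
      _ = θ ^ n := by simp
  have hθn : θ ^ n ≤ θ ^ 2 := pow_le_pow_of_le_one hθ0 hθ1 hn
  calc |PU y n c| ≤ _ := h44 y n c
    _ ≤ C * θ ^ n := mul_le_mul_of_nonneg_left hprod hC
    _ ≤ C * θ ^ 2 := mul_le_mul_of_nonneg_left hθn hC

end Terms43

section Resummation45

/-!
### v1.2 (append-only, same unit): the printed proof (44) ⇒ (45) ⇒ (46), pp. 266–267

The two summations that p. 267 [13] performs in words are certified here as real finite-sum bookkeeping over the
geometry carrier `VertexGeometry` (render `…-p013-x2.png` re-read 2026-08-20 for this section):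

* *"By the assumption n ≥ 2, summation over all Y_j with y fixed yields for g_{k−1} sufficiently small (45)"* —
  `blockSum45_le_two_mul_sq` / `bound45_of_bound44`: under (44) the terms of degree `n` localized at the block `y₀` sum
  to at most `O(1)·sⁿ`, `s` = the one-bond sum of the factors of (44) (distributivity); the degree floor `n ≥ 2` of (43)
  and `s ≤ ½` (the printed *"g_{k−1} sufficiently small"*) give the geometric tail `Σ_{n≥2} O(1)sⁿ ≤ 2·O(1)·s²`, which
  is (45) with `(O(M₁³)g_{k−1}p(g_{k−1}))²(L^jη)⁴ = s²`-shape once the one-block lattice sum is bounded by a constant `Z`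
  (print evaluates it as `O(M₁³)`; cell census C-B10-1: the power of `M₁` is not load-bearing — NOT re-derived here,
  `Z` is any bound of that sum);
* *"Summation over y gives the factor (M₁L^jη)^{−3}|Λ_k|, and finally summation over j = 1, …, k gives … (46)"* —
  `bound46_of_bound45`: with at most `(M₁L^jη)^{−3}|Λ_k|` blocks at level `j` and `L^jη = L^{j−k}` (`η = L^{−k}`), the
  per-level total is `O(1)·CM²·M₁^{−3}·(g p(g))²·|Λ_k|·L^{j−k}` and the scale sum is the d = 3 power counting
  `Σ_{j=1}^{k} L^{j−k} ≤ L/(L − 1)` of `B10.powerCounting_d3` (cell module `…B10`, imported for that lemma only);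
  `bound46_printed_shape` rewrites the result in the printed form `O(1)M₁³g²_{k−1}p²(g_{k−1})|Λ_k|` when `CM = O(1)·M₁³`.

Nothing of the series is used: (44) is the hypothesis `Bound44`, the loop variables, minimizers and activities stay
names.  Value = SKELETON rows E45/E46 of `HOME/SKELETON.md` §B10 move from "typed" to "typed + printed inference
kernel-checked"; NOT summit progress.
-/

open Finset

/-- The one-loop-variable factor of the right-hand side of **(44)** p. 267 [13] attached to a bond `b` and a block `y`:
`exp(−κ₁(M₁ℓ)⁻¹|b₋ − y|)·((ℓ⁻¹|b₋ − y|)·(8L²B₃ g p(g) ℓ²))` (`ℓ = L^jη`, `g = g_{k−1}`), so that (44) reads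
`|𝒫_j(Y_j, U_k)| ≤ O(1) Π_{i=1}^n factor44(c_i)` (`bound44_iff_factor44`).  A definition with body (a bookkeeping name
for the printed factor; nothing constructed). [cite: Balaban1985UV3, (44) p.267] -/
noncomputable def factor44 (X : VertexGeometry) (κ₁ M₁ ℓ L B₃ g pg : ℝ) (y : X.Site) (b : X.Bond) : ℝ :=
  Real.exp (-(κ₁ * (M₁ * ℓ)⁻¹ * X.dist (X.cminus b) y)) *
    ((ℓ⁻¹ * X.dist (X.cminus b) y) * (8 * L ^ 2 * B₃ * g * pg * ℓ ^ 2))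

/-- (44) is, by definition, the bound `|𝒫_j(Y_j, U_k)| ≤ C·Π_i factor44(c_i)`. [cite: Balaban1985UV3, (44) p.267] -/
theorem bound44_iff_factor44 (X : VertexGeometry) (PU : TermSizes X) (κ₁ M₁ ℓ L B₃ g pg C : ℝ) :
    Bound44 X PU κ₁ M₁ ℓ L B₃ g pg C ↔
      ∀ (y : X.Site) (n : ℕ) (c : Fin n → X.Bond),
        |PU y n c| ≤ C * ∏ i, factor44 X κ₁ M₁ ℓ L B₃ g pg y (c i) :=
  Iff.rfl

/-- The factors of (44) are non-negative for `ℓ > 0`, `B₃, g, p(g) ≥ 0` and non-negative distances. [cite: Balaban1985UV3, (44) p.267] -/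
theorem factor44_nonneg (X : VertexGeometry) {κ₁ M₁ ℓ L B₃ g pg : ℝ} (hℓ : 0 < ℓ) (hB : 0 ≤ B₃)
    (hg : 0 ≤ g) (hpg : 0 ≤ pg) (hdist : ∀ x y, 0 ≤ X.dist x y) (y : X.Site) (b : X.Bond) :
    0 ≤ factor44 X κ₁ M₁ ℓ L B₃ g pg y b := by
  unfold factor44
  have h1 : 0 ≤ ℓ⁻¹ * X.dist (X.cminus b) y := mul_nonneg (inv_nonneg.mpr hℓ.le) (hdist _ _)
  have h2 : 0 ≤ 8 * L ^ 2 * B₃ * g * pg * ℓ ^ 2 := by positivity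
  exact mul_nonneg (Real.exp_pos _).le (mul_nonneg h1 h2)

/-- The one-bond sum of the factors of (44) over a finite set of bonds `S` is `8L²B₃ g p(g) ℓ²` times the lattice sum
`Σ_{b ∈ S} exp(−κ₁(M₁ℓ)⁻¹|b₋ − y|)·(ℓ⁻¹|b₋ − y|)` (the sum that p. 267 evaluates as `O(M₁³)`). Real algebra.
[cite: Balaban1985UV3, (44)–(45) p.267] -/
theorem sum_factor44_eq (X : VertexGeometry) (κ₁ M₁ ℓ L B₃ g pg : ℝ) (y : X.Site) (S : Finset X.Bond) :
    ∑ b ∈ S, factor44 X κ₁ M₁ ℓ L B₃ g pg y b =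
      (8 * L ^ 2 * B₃ * g * pg * ℓ ^ 2) *
        ∑ b ∈ S, Real.exp (-(κ₁ * (M₁ * ℓ)⁻¹ * X.dist (X.cminus b) y)) * (ℓ⁻¹ * X.dist (X.cminus b) y) := by
  rw [Finset.mul_sum]
  refine Finset.sum_congr rfl fun b _ => ?_
  unfold factor44
  ring

/-- The left-hand side of **(45)** p. 267 [13], *"Σ_{Y_j : y = y₀} |𝒫_j(Y_j, U_k)|"*: the sum of the sizes
`|𝒫_j(Y_j, U_k)|` of all terms `Y_j = (y₀, c₁, …, c_n)` localized at the fixed block `y₀`, the bonds `c_i` ranging over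
the finite set `adm y₀` of admissible bonds ((43) p. 266: *"c_i are bonds in Ω_k^{(j)}, |c_{i,−} − y| < R(g_j)M₁L^jη"*)
and the degree `n` over `0, …, N` (the terms of (43) come from expansions of finite order; the bound (45) below is
uniform in the cut-off `N`).  A definition with body over the per-term sizes `PU` of (44). [cite: Balaban1985UV3, (45) p.267] -/
noncomputable def blockSum45 (X : VertexGeometry) (PU : TermSizes X) (adm : X.Site → Finset X.Bond) (N : ℕ)
    (y₀ : X.Site) : ℝ :=
  ∑ n ∈ Finset.range (N + 1), ∑ c ∈ Fintype.piFinset (fun _ : Fin n => adm y₀), |PU y₀ n c|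

/-- The block sums of (45) are non-negative. [cite: Balaban1985UV3, (45) p.267] -/
theorem blockSum45_nonneg (X : VertexGeometry) (PU : TermSizes X) (adm : X.Site → Finset X.Bond) (N : ℕ)
    (y₀ : X.Site) : 0 ≤ blockSum45 X PU adm N y₀ :=
  Finset.sum_nonneg fun _ _ => Finset.sum_nonneg fun _ _ => abs_nonneg _

/-- CERTIFIED BOOKKEEPING, one degree `n` of the summation behind (45): under (44),
`Σ_{c₁,…,c_n ∈ adm y₀} |𝒫_j((y₀, c₁, …, c_n), U_k)| ≤ O(1)·(Σ_{b ∈ adm y₀} factor44(b))ⁿ` (distributivity of the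
product of (44), Mathlib `Finset.sum_pow'`).  Real algebra; no content of the series. [cite: Balaban1985UV3, (44)–(45) p.267] -/
theorem degreeSum_le_pow (X : VertexGeometry) (PU : TermSizes X) (adm : X.Site → Finset X.Bond)
    {κ₁ M₁ ℓ L B₃ g pg C : ℝ} (h44 : Bound44 X PU κ₁ M₁ ℓ L B₃ g pg C) (y₀ : X.Site) (n : ℕ) :
    ∑ c ∈ Fintype.piFinset (fun _ : Fin n => adm y₀), |PU y₀ n c| ≤
      C * (∑ b ∈ adm y₀, factor44 X κ₁ M₁ ℓ L B₃ g pg y₀ b) ^ n := by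
  classical
  rw [Finset.sum_pow', Finset.mul_sum]
  exact Finset.sum_le_sum fun c _ => h44 y₀ n c

/-- The degree floor of (43) (*"n ≥ 2"*): degrees `n < 2` contribute nothing to the block sum. [cite: Balaban1985UV3, (43) p.266, (45) p.267] -/
theorem degreeSum_eq_zero_of_floor (X : VertexGeometry) (PU : TermSizes X) (adm : X.Site → Finset X.Bond)
    (hfloor : ∀ (y : X.Site) (n : ℕ) (c : Fin n → X.Bond), PU y n c ≠ 0 → 2 ≤ n) (y₀ : X.Site) {n : ℕ}
    (hn : n < 2) : ∑ c ∈ Fintype.piFinset (fun _ : Fin n => adm y₀), |PU y₀ n c| = 0 := by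
  refine Finset.sum_eq_zero fun c _ => ?_
  by_contra hne
  have h2 := hfloor y₀ n c (fun h0 => hne (by rw [h0, abs_zero]))
  omega

/-- Finite geometric sums are bounded by the full series: `Σ_{m<M} s^m ≤ (1 − s)⁻¹` for `0 ≤ s < 1` (Mathlib
`tsum_geometric_of_lt_one`). [folklore] -/
private theorem geom_partial_sum_le {s : ℝ} (hs0 : 0 ≤ s) (hs1 : s < 1) (M : ℕ) :
    ∑ m ∈ Finset.range M, s ^ m ≤ (1 - s)⁻¹ :=
  calc ∑ m ∈ Finset.range M, s ^ m ≤ ∑' m, s ^ m :=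
      (summable_geometric_of_lt_one hs0 hs1).sum_le_tsum _ (fun i _ => pow_nonneg hs0 i)
    _ = (1 - s)⁻¹ := tsum_geometric_of_lt_one hs0 hs1

/-- **(44) ⇒ (45)** p. 267 [13] — the printed inference *"By the assumption n ≥ 2, summation over all Y_j with y fixed
yields for g_{k−1} sufficiently small"* (45), made quantitative: if the evaluated terms obey (44) with constant `C ≥ 0`,
only degrees `n ≥ 2` occur (the floor of (43)), and the one-bond sum `s = Σ_{b ∈ adm y₀} factor44(b)` satisfies
`0 ≤ s ≤ ½` (this is the *"g_{k−1} sufficiently small"*), then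
`Σ_{Y_j : y = y₀} |𝒫_j(Y_j, U_k)| ≤ Σ_{2 ≤ n ≤ N} C sⁿ ≤ C s²(1 − s)⁻¹ ≤ 2C s²`, uniformly in the degree cut-off `N`.
Certified bookkeeping (distributivity + geometric series); no content of the series. [cite: Balaban1985UV3, (44)–(45) p.267] -/
theorem blockSum45_le_two_mul_sq (X : VertexGeometry) (PU : TermSizes X) (adm : X.Site → Finset X.Bond)
    {κ₁ M₁ ℓ L B₃ g pg C : ℝ} (hC : 0 ≤ C) (h44 : Bound44 X PU κ₁ M₁ ℓ L B₃ g pg C)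
    (hfloor : ∀ (y : X.Site) (n : ℕ) (c : Fin n → X.Bond), PU y n c ≠ 0 → 2 ≤ n) (y₀ : X.Site)
    (hf0 : 0 ≤ ∑ b ∈ adm y₀, factor44 X κ₁ M₁ ℓ L B₃ g pg y₀ b)
    (hs : ∑ b ∈ adm y₀, factor44 X κ₁ M₁ ℓ L B₃ g pg y₀ b ≤ 1 / 2) (N : ℕ) :
    blockSum45 X PU adm N y₀ ≤ 2 * C * (∑ b ∈ adm y₀, factor44 X κ₁ M₁ ℓ L B₃ g pg y₀ b) ^ 2 := by
  classical
  set s := ∑ b ∈ adm y₀, factor44 X κ₁ M₁ ℓ L B₃ g pg y₀ b with hs_def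
  have hs1 : s < 1 := by linarith
  have hCs2 : 0 ≤ C * s ^ 2 := mul_nonneg hC (sq_nonneg s)
  have hinv : (1 - s)⁻¹ ≤ 2 := by
    have h := inv_anti₀ (by norm_num : (0 : ℝ) < 1 / 2) (by linarith : 1 / 2 ≤ 1 - s)
    norm_num at h
    exact h
  -- the tail `Σ_{2 ≤ n ≤ N} C sⁿ = C s² Σ_{m ≤ N-2} s^m ≤ C s² (1 - s)⁻¹`
  have htail : ∑ n ∈ Finset.Ico 2 (N + 1), C * s ^ n ≤ C * s ^ 2 * (1 - s)⁻¹ := by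
    rw [Finset.sum_Ico_eq_sum_range]
    have hre : ∑ k ∈ Finset.range (N + 1 - 2), C * s ^ (2 + k) =
        C * s ^ 2 * ∑ k ∈ Finset.range (N + 1 - 2), s ^ k := by
      rw [Finset.mul_sum]
      exact Finset.sum_congr rfl fun k _ => by rw [pow_add]; ring
    rw [hre]
    exact mul_le_mul_of_nonneg_left (geom_partial_sum_le hf0 hs1 _) hCs2
  unfold blockSum45
  rcases Nat.lt_or_ge N 1 with hN | hN
  · -- N = 0: only the (vanishing) degree-0 term
    have hN0 : N = 0 := by omega
    subst hN0
    rw [Finset.sum_range_one, degreeSum_eq_zero_of_floor X PU adm hfloor y₀ (by omega : 0 < 2)]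
    positivity
  · rw [Finset.range_eq_Ico, ← Finset.sum_Ico_consecutive _ (by omega : 0 ≤ 2) (by omega : 2 ≤ N + 1)]
    have h01 : ∑ n ∈ Finset.Ico 0 2, ∑ c ∈ Fintype.piFinset (fun _ : Fin n => adm y₀), |PU y₀ n c| = 0 := by
      refine Finset.sum_eq_zero fun n hn => ?_
      rw [Finset.mem_Ico] at hn
      exact degreeSum_eq_zero_of_floor X PU adm hfloor y₀ hn.2
    rw [h01, zero_add]
    calc ∑ n ∈ Finset.Ico 2 (N + 1), ∑ c ∈ Fintype.piFinset (fun _ : Fin n => adm y₀), |PU y₀ n c|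
        ≤ ∑ n ∈ Finset.Ico 2 (N + 1), C * s ^ n :=
          Finset.sum_le_sum fun n _ => degreeSum_le_pow X PU adm h44 y₀ n
      _ ≤ C * s ^ 2 * (1 - s)⁻¹ := htail
      _ ≤ C * s ^ 2 * 2 := mul_le_mul_of_nonneg_left hinv hCs2
      _ = 2 * C * s ^ 2 := by ring

/-- The *"g_{k−1} sufficiently small"* of (45) is ONE condition for all scales `j ≤ k`: since `L^jη = L^{j−k} ≤ 1`,
the smallness `8L²B₃Z·g p(g)·(L^jη)² ≤ ½` needed at scale `j` follows from the scale-free `8L²B₃Z·g p(g) ≤ ½`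
(with `Z` a scale-free bound of the one-block lattice sum).  Real arithmetic. [cite: Balaban1985UV3, (45) p.267] -/
theorem smallness45_of_scaleFree {L B₃ Z g pg ℓ : ℝ} (hpre : 0 ≤ 8 * L ^ 2 * B₃ * Z * g * pg) (hℓ0 : 0 ≤ ℓ)
    (hℓ1 : ℓ ≤ 1) (h : 8 * L ^ 2 * B₃ * Z * g * pg ≤ 1 / 2) : 8 * L ^ 2 * B₃ * Z * g * pg * ℓ ^ 2 ≤ 1 / 2 := by
  have hℓ2 : ℓ ^ 2 ≤ 1 := pow_le_one₀ hℓ0 hℓ1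
  calc 8 * L ^ 2 * B₃ * Z * g * pg * ℓ ^ 2 ≤ 8 * L ^ 2 * B₃ * Z * g * pg * 1 :=
      mul_le_mul_of_nonneg_left hℓ2 hpre
    _ ≤ 1 / 2 := by rw [mul_one]; exact h

/-- **(45)** p. 267 [13] DERIVED from (44) in the typed shape `Bound45`, verbatim target: *"Σ_{Y_j : y = y₀}
|𝒫_j(Y_j, U_k)| ≤ O(1)(O(M₁³)g_{k−1}p(g_{k−1}))²(L^jη)⁴"*.  Hypotheses: (44) with `C ≥ 0`; the degree floor `n ≥ 2`
of (43); signs (`ℓ = L^jη > 0`, `B₃, g, p(g) ≥ 0`, distances `≥ 0`); a bound `Z` of the one-block lattice sum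
`Σ_{b ∈ adm y₀} exp(−κ₁(M₁L^jη)⁻¹|b₋ − y₀|)·(L^jη)⁻¹|b₋ − y₀|` uniform in the block `y₀` (print: `O(M₁³)`, i.e. the
printed `O(M₁³)` is `8L²B₃·Z` here up to the absorbed numerical factor; the evaluation of `Z` is NOT re-derived — cell
census C-B10-1); and the smallness `8L²B₃Z·g p(g)·(L^jη)² ≤ ½` (*"for g_{k−1} sufficiently small"*;
`smallness45_of_scaleFree`).  Conclusion: (45) holds for the block sums `blockSum45` with `CM = 8L²B₃Z` and
`O(1) = 2C`, uniformly in the degree cut-off `N`.  Certified bookkeeping; no content of the series.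
[cite: Balaban1985UV3, (44)–(45) p.267] -/
theorem bound45_of_bound44 (X : VertexGeometry) (PU : TermSizes X) (adm : X.Site → Finset X.Bond) (N : ℕ)
    {κ₁ M₁ ℓ L B₃ g pg C Z : ℝ} (hC : 0 ≤ C) (hℓ : 0 < ℓ) (hB : 0 ≤ B₃) (hg : 0 ≤ g) (hpg : 0 ≤ pg)
    (hdist : ∀ x y, 0 ≤ X.dist x y) (h44 : Bound44 X PU κ₁ M₁ ℓ L B₃ g pg C)
    (hfloor : ∀ (y : X.Site) (n : ℕ) (c : Fin n → X.Bond), PU y n c ≠ 0 → 2 ≤ n)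
    (hZ : ∀ y₀ : X.Site, ∑ b ∈ adm y₀,
      Real.exp (-(κ₁ * (M₁ * ℓ)⁻¹ * X.dist (X.cminus b) y₀)) * (ℓ⁻¹ * X.dist (X.cminus b) y₀) ≤ Z)
    (hsmall : 8 * L ^ 2 * B₃ * Z * g * pg * ℓ ^ 2 ≤ 1 / 2) :
    Bound45 X (blockSum45 X PU adm N) (8 * L ^ 2 * B₃ * Z) g pg ℓ (2 * C) := by
  intro y₀
  have hf0' : ∀ b, 0 ≤ factor44 X κ₁ M₁ ℓ L B₃ g pg y₀ b := factor44_nonneg X hℓ hB hg hpg hdist y₀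
  have hf0 : 0 ≤ ∑ b ∈ adm y₀, factor44 X κ₁ M₁ ℓ L B₃ g pg y₀ b := Finset.sum_nonneg fun b _ => hf0' b
  have hpre : 0 ≤ 8 * L ^ 2 * B₃ * g * pg * ℓ ^ 2 := by positivity
  have hsZ : ∑ b ∈ adm y₀, factor44 X κ₁ M₁ ℓ L B₃ g pg y₀ b ≤ (8 * L ^ 2 * B₃ * Z) * g * pg * ℓ ^ 2 := by
    rw [sum_factor44_eq]
    calc (8 * L ^ 2 * B₃ * g * pg * ℓ ^ 2) * _ ≤ (8 * L ^ 2 * B₃ * g * pg * ℓ ^ 2) * Z :=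
          mul_le_mul_of_nonneg_left (hZ y₀) hpre
      _ = (8 * L ^ 2 * B₃ * Z) * g * pg * ℓ ^ 2 := by ring
  have hs : ∑ b ∈ adm y₀, factor44 X κ₁ M₁ ℓ L B₃ g pg y₀ b ≤ 1 / 2 :=
    hsZ.trans (le_of_eq_of_le (by ring) hsmall)
  calc blockSum45 X PU adm N y₀ ≤ 2 * C * (∑ b ∈ adm y₀, factor44 X κ₁ M₁ ℓ L B₃ g pg y₀ b) ^ 2 :=
        blockSum45_le_two_mul_sq X PU adm hC h44 hfloor y₀ hf0 hs N
    _ ≤ 2 * C * ((8 * L ^ 2 * B₃ * Z) * g * pg * ℓ ^ 2) ^ 2 := by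
        apply mul_le_mul_of_nonneg_left _ (by positivity)
        exact pow_le_pow_left₀ hf0 hsZ 2
    _ = 2 * C * ((8 * L ^ 2 * B₃ * Z) * g * pg) ^ 2 * ℓ ^ 4 := by ring

/-- Re-indexing of the scale sum of (46): `Σ_{j=1}^{k} q^{k−j} = Σ_{m<k} q^m` (`m = k − j`). [folklore] -/
private theorem sum_Icc_pow_sub_eq (q : ℝ) (k : ℕ) :
    ∑ j ∈ Finset.Icc 1 k, q ^ (k - j) = ∑ m ∈ Finset.range k, q ^ m := by
  refine Finset.sum_nbij' (fun j => k - j) (fun m => k - m) ?_ ?_ ?_ ?_ ?_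
  · intro j hj
    simp only [Finset.mem_Icc] at hj
    simp only [Finset.mem_range]
    omega
  · intro m hm
    simp only [Finset.mem_range] at hm
    simp only [Finset.mem_Icc]
    omega
  · intro j hj
    simp only [Finset.mem_Icc] at hj
    omega
  · intro m hm
    simp only [Finset.mem_range] at hm
    omega
  · intro j _
    rfl

/-- **(45) ⇒ (46)** p. 267 [13] — the printed inference *"Summation over y gives the factor (M₁L^jη)^{−3}|Λ_k|, and
finally summation over j = 1, …, k gives the following bound for the sum of interaction terms in (41), (46)
Σ_{j=1}^k Σ_{Y_j} |𝒫_j(Y_j, U_k)| ≤ O(1)M₁³g²_{k−1}p²(g_{k−1})|Λ_k|"*, made quantitative.  Data: for each scale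
`j = 1, …, k` the finite set `blocks j` of big blocks `y` of the `L^jη`-lattice and the block sums `S j y`
(= `Σ_{Y_j : y} |𝒫_j(Y_j, U_k)|`); `ℓ j = L^jη = L^{j−k}` (`η = L^{−k}`, so `ℓ j = (L⁻¹)^{k−j}`); `Λvol = |Λ_k|`.
Hypotheses: (45) at every scale with the same constants (`Bound45`, e.g. from `bound45_of_bound44`); the printed block
count `#(blocks j) ≤ (M₁L^jη)^{−3}|Λ_k|`; `L > 1`, `M₁ > 0`, `C, |Λ_k| ≥ 0`.  Conclusion:
`Σ_{j=1}^{k} Σ_{y} S j y ≤ C·CM²·M₁^{−3}·(L/(L − 1))·(g p(g))²·|Λ_k|` — per level `C(CM g p(g))²(L^jη)⁴ ×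
(M₁L^jη)^{−3}|Λ_k| = C·CM²M₁^{−3}(g p(g))²|Λ_k|·L^jη`, and the scale sum `Σ_{j=1}^{k} L^{j−k} ≤ L/(L − 1)` is the d = 3
power counting `B10.powerCounting_d3` (p. 267: *"Because n ≥ 2, so L^{−2n} ≤ L^{−4} and the functions 𝒫_j(Y_j, U_k)
behave like irrelevant variables in the dimensions 3"*).  With `CM = O(1)·M₁³` this is the printed
`O(1)M₁³g²_{k−1}p²(g_{k−1})|Λ_k|` (`bound46_printed_shape`).  Certified bookkeeping; no content of the series.
[cite: Balaban1985UV3, (45)–(46) p.267] -/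
theorem bound46_of_bound45 (X : VertexGeometry) (k : ℕ) (blocks : ℕ → Finset X.Site) (S : ℕ → X.Site → ℝ)
    (ℓ : ℕ → ℝ) {L M₁ CM g pg C Λvol : ℝ} (hL : 1 < L) (hM : 0 < M₁) (hC : 0 ≤ C) (hΛ : 0 ≤ Λvol)
    (hℓ : ∀ j ∈ Finset.Icc 1 k, ℓ j = L⁻¹ ^ (k - j))
    (h45 : ∀ j ∈ Finset.Icc 1 k, Bound45 X (S j) CM g pg (ℓ j) C)
    (hcard : ∀ j ∈ Finset.Icc 1 k, ((blocks j).card : ℝ) ≤ (M₁ * ℓ j)⁻¹ ^ 3 * Λvol) :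
    ∑ j ∈ Finset.Icc 1 k, ∑ y ∈ blocks j, S j y ≤
      C * CM ^ 2 * M₁⁻¹ ^ 3 * (L / (L - 1)) * (g * pg) ^ 2 * Λvol := by
  have hL0 : 0 < L := by linarith
  have hq0 : 0 ≤ L⁻¹ := inv_nonneg.mpr hL0.le
  have hℓpos : ∀ j ∈ Finset.Icc 1 k, 0 < ℓ j := fun j hj => by rw [hℓ j hj]; positivity
  -- one scale: "Summation over y gives the factor (M₁L^jη)^{−3}|Λ_k|"
  have hlevel : ∀ j ∈ Finset.Icc 1 k, ∑ y ∈ blocks j, S j y ≤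
      C * CM ^ 2 * M₁⁻¹ ^ 3 * (g * pg) ^ 2 * Λvol * ℓ j := by
    intro j hj
    have hb : ∀ y ∈ blocks j, S j y ≤ C * (CM * g * pg) ^ 2 * ℓ j ^ 4 := fun y _ => h45 j hj y
    have hnn : 0 ≤ C * (CM * g * pg) ^ 2 * ℓ j ^ 4 := by
      have := (hℓpos j hj).le
      positivity
    calc ∑ y ∈ blocks j, S j y ≤ ∑ _y ∈ blocks j, C * (CM * g * pg) ^ 2 * ℓ j ^ 4 := Finset.sum_le_sum hb
      _ = (blocks j).card * (C * (CM * g * pg) ^ 2 * ℓ j ^ 4) := by rw [Finset.sum_const, nsmul_eq_mul]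
      _ ≤ (M₁ * ℓ j)⁻¹ ^ 3 * Λvol * (C * (CM * g * pg) ^ 2 * ℓ j ^ 4) :=
          mul_le_mul_of_nonneg_right (hcard j hj) hnn
      _ = C * CM ^ 2 * M₁⁻¹ ^ 3 * (g * pg) ^ 2 * Λvol * ℓ j := by
          have hℓ0 : ℓ j ≠ 0 := (hℓpos j hj).ne'
          have hM0 : M₁ ≠ 0 := hM.ne'
          field_simp
  -- all scales: "summation over j = 1, …, k" = the d = 3 power counting Σ_j L^{j−k} ≤ L/(L−1)
  have hscale : ∑ j ∈ Finset.Icc 1 k, ℓ j ≤ L / (L - 1) := by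
    calc ∑ j ∈ Finset.Icc 1 k, ℓ j = ∑ j ∈ Finset.Icc 1 k, L⁻¹ ^ (k - j) := Finset.sum_congr rfl hℓ
      _ = ∑ m ∈ Finset.range k, L⁻¹ ^ m := sum_Icc_pow_sub_eq L⁻¹ k
      _ ≤ L / (L - 1) := by simpa using B10.powerCounting_d3 L hL k
  have hK : 0 ≤ C * CM ^ 2 * M₁⁻¹ ^ 3 * (g * pg) ^ 2 * Λvol := by
    have := hM.le
    positivity
  calc ∑ j ∈ Finset.Icc 1 k, ∑ y ∈ blocks j, S j y
      ≤ ∑ j ∈ Finset.Icc 1 k, C * CM ^ 2 * M₁⁻¹ ^ 3 * (g * pg) ^ 2 * Λvol * ℓ j := Finset.sum_le_sum hlevel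
    _ = C * CM ^ 2 * M₁⁻¹ ^ 3 * (g * pg) ^ 2 * Λvol * ∑ j ∈ Finset.Icc 1 k, ℓ j := by rw [Finset.mul_sum]
    _ ≤ C * CM ^ 2 * M₁⁻¹ ^ 3 * (g * pg) ^ 2 * Λvol * (L / (L - 1)) := mul_le_mul_of_nonneg_left hscale hK
    _ = C * CM ^ 2 * M₁⁻¹ ^ 3 * (L / (L - 1)) * (g * pg) ^ 2 * Λvol := by ring

/-- The printed shape of **(46)**: when the block-sum constant of (45) is `CM = O(1)·M₁³` (print: `(O(M₁³)g_{k−1}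
p(g_{k−1}))²`), the bound of `bound46_of_bound45` is `O(1)·M₁³·g²_{k−1}p²(g_{k−1})·|Λ_k|` with
`O(1) = C·CM′²·L/(L − 1)` — the integrand shape of `B10.Bound46Printed`.  Real algebra. [cite: Balaban1985UV3, (46) p.267] -/
theorem bound46_printed_shape {L M₁ CM' g pg C Λvol : ℝ} (hM : 0 < M₁) :
    C * (CM' * M₁ ^ 3) ^ 2 * M₁⁻¹ ^ 3 * (L / (L - 1)) * (g * pg) ^ 2 * Λvol =
      (C * CM' ^ 2 * (L / (L - 1))) * M₁ ^ 3 * (g ^ 2 * pg ^ 2) * Λvol := by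
  have hM0 : M₁ ≠ 0 := hM.ne'
  field_simp

end Resummation45

end Literature.MathematicalPhysics.QuantumFieldTheory.Balaban1983to89.B10SectCExpansion
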